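import Mathlib
import Summits.MatrixMultiplication.MatrixMultiplication.Theorems.SnSubsetDichotomyPolynomialSlackCylinderPull
import Summits.MatrixMultiplication.MatrixMultiplication.Theorems.SnSubsetDichotomyPolynomialSlackCylinderCost
import Summits.MatrixMultiplication.MatrixMultiplication.Theorems.SnSubsetDichotomyPolynomialSlackStubSplit

/-!
# TPP triples with a level-one-flat point-cylinder member have polynomial slack at every exponent `C < 1`

Crux `Summit.MatrixMultiplication.MatrixMultiplication.Theses.SnSubsetDichotomy.PolynomialSlack`
(item `stmt-MatrixMultiplication-8306`), level-one programme, lead c3 (crux notes §C): the assembly of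
`cylinder_pullback_pinned` (the level-one datum of a parity-pure TPP triple whose member `U` lies in a point
cylinder `{u : u j₀ = i₀}` pins `n·P/(|S|²|T|²) ≤ (n-1)η' + n!/(2N) + n!^{3/2}/(2N√D)`) with `quotient_cost`
(such a pinning of the unique-quotient pair `(S,T)` costs `|S||T| ≤ 4n!·e^{-1/(1250(1+log n)β)}`) and the
packing bounds `|T||U|, |U||S| ≤ n!`:

* `cylinderMember_slack` — for `0 ≤ C < 1` there is `n₀` such that for `n ≥ n₀` every parity-pure TPP triple
  `S, T, U ⊆ S_n` with `U ⊆ {u : u j₀ = i₀}` and inner level-one energy `(n-1)·η'_U ≤ n^{C-1}`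
  (`η'_U = Σ_v Σ_{q ≠ j₀} (c_U(v,q)/|U| - [v ≠ i₀]/(n-1))²`, e.g. every `U` that is level-one pseudorandom inside
  its cylinder) satisfies the crux inequality `|S||T||U|·n^C ≤ (n!)^{3/2}`.

So in the LOPSIDED regime left open by c2's level-one results (`MinCard`, `RatioSlack`), a smallest member
sitting flatly in a point cylinder is excluded at every exponent below `1`: beyond BCGPU's `1/2` for this
class, unconditionally. The threshold is explicit but astronomical (`n₀ ≈ (10⁵(1+C)/δ²)^{2/δ}`, `δ = 1 - C`).
-/

namespace Summit.MatrixMultiplication.MatrixMultiplication.Theorems.PolynomialSlack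

open scoped BigOperators
open Literature.Combinatorics.Additive (TripleProductProperty)

set_option linter.dupNamespace false

/-- Polylogarithms are eventually below powers: for `δ > 0` and any `K` there is `n₀` with
`K·(1 + log n)² ≤ n^δ` for all `n ≥ n₀` (from `log x ≤ x^ε/ε`). [folklore] -/
theorem exists_mul_log_sq_le_rpow (K δ : ℝ) (hδ : 0 < δ) :
    ∃ n₀ : ℕ, ∀ n : ℕ, n₀ ≤ n → K * (1 + Real.log n) ^ 2 ≤ (n : ℝ) ^ δ := by
  set M : ℝ := max 1 (K * (1 + 4 / δ) ^ 2) with hM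
  have hM1 : 1 ≤ M := le_max_left _ _
  have hM0 : 0 < M := by linarith
  obtain ⟨n₀, hn₀⟩ := exists_nat_ge (M ^ (2 / δ))
  refine ⟨max n₀ 1, fun n hn => ?_⟩
  have hn1 : (1 : ℝ) ≤ n := by exact_mod_cast (le_max_right n₀ 1).trans hn
  have hn0 : (0 : ℝ) < n := by linarith
  have hnM : M ^ (2 / δ) ≤ (n : ℝ) := hn₀.trans (by exact_mod_cast (le_max_left n₀ 1).trans hn)
  -- `M ≤ n^{δ/2}`
  have hpow : M ≤ (n : ℝ) ^ (δ / 2) := by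
    have h1 : (M ^ (2 / δ)) ^ (δ / 2) ≤ (n : ℝ) ^ (δ / 2) :=
      Real.rpow_le_rpow (by positivity) hnM (by positivity)
    rwa [← Real.rpow_mul hM0.le, show 2 / δ * (δ / 2) = 1 by field_simp, Real.rpow_one] at h1
  -- `1 + log n ≤ (1 + 4/δ)·n^{δ/4}`
  have hq0 : (1 : ℝ) ≤ (n : ℝ) ^ (δ / 4) := Real.one_le_rpow hn1 (by positivity)
  have hlog : Real.log n ≤ (n : ℝ) ^ (δ / 4) / (δ / 4) := Real.log_le_rpow_div hn0.le (by positivity)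
  have hlog0 : 0 ≤ Real.log n := Real.log_nonneg hn1
  have h1 : 1 + Real.log n ≤ (1 + 4 / δ) * (n : ℝ) ^ (δ / 4) := by
    rw [add_mul, one_mul]
    have : (n : ℝ) ^ (δ / 4) / (δ / 4) = 4 / δ * (n : ℝ) ^ (δ / 4) := by field_simp
    linarith
  have h2 : (1 + Real.log n) ^ 2 ≤ (1 + 4 / δ) ^ 2 * (n : ℝ) ^ (δ / 2) := by
    have hsq : ((n : ℝ) ^ (δ / 4)) ^ 2 = (n : ℝ) ^ (δ / 2) := by
      rw [← Real.rpow_natCast, ← Real.rpow_mul hn0.le]; norm_num; ring_nf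
    calc (1 + Real.log n) ^ 2 ≤ ((1 + 4 / δ) * (n : ℝ) ^ (δ / 4)) ^ 2 :=
          pow_le_pow_left₀ (by linarith) h1 2
      _ = (1 + 4 / δ) ^ 2 * (n : ℝ) ^ (δ / 2) := by rw [mul_pow, hsq]
  have hδ2 : (n : ℝ) ^ δ = (n : ℝ) ^ (δ / 2) * (n : ℝ) ^ (δ / 2) := by
    rw [← Real.rpow_add hn0]; ring_nf
  have hnd0 : 0 ≤ (n : ℝ) ^ (δ / 2) := Real.rpow_nonneg hn0.le _
  by_cases hK : K ≤ 0
  · calc K * (1 + Real.log n) ^ 2 ≤ 0 := mul_nonpos_of_nonpos_of_nonneg hK (sq_nonneg _)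
      _ ≤ (n : ℝ) ^ δ := Real.rpow_nonneg hn0.le _
  have hK : 0 < K := not_le.1 hK
  have hKM : K * (1 + 4 / δ) ^ 2 ≤ M := le_max_right _ _
  calc K * (1 + Real.log n) ^ 2 ≤ K * ((1 + 4 / δ) ^ 2 * (n : ℝ) ^ (δ / 2)) :=
        mul_le_mul_of_nonneg_left h2 hK.le
    _ = (K * (1 + 4 / δ) ^ 2) * (n : ℝ) ^ (δ / 2) := by ring
    _ ≤ M * (n : ℝ) ^ (δ / 2) := mul_le_mul_of_nonneg_right hKM hnd0
    _ ≤ (n : ℝ) ^ (δ / 2) * (n : ℝ) ^ (δ / 2) := mul_le_mul_of_nonneg_right hpow hnd0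
    _ = (n : ℝ) ^ δ := hδ2.symm

/-- `n² ≤ 4·n!` for `n ≥ 2`. [folklore] -/
theorem sq_le_four_mul_factorial {n : ℕ} (hn : 2 ≤ n) : n * n ≤ 4 * n.factorial := by
  obtain ⟨m, rfl⟩ : ∃ m, n = m + 1 := ⟨n - 1, by omega⟩
  rw [Nat.factorial_succ]
  have h1 : m ≤ m.factorial := Nat.self_le_factorial m
  have h2 : 1 ≤ m.factorial := Nat.one_le_iff_ne_zero.2 (Nat.factorial_ne_zero m)
  nlinarith

set_option maxHeartbeats 800000 in
/-- **A level-one-flat point-cylinder member forces polynomial slack below exponent one.** For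
`0 ≤ C < 1` there is `n₀` such that for all `n ≥ n₀`, all `i₀ j₀ : Fin n` and every TPP triple
`S, T, U ⊆ S_n` whose three members are sign-pure, with `U ⊆ {u : u j₀ = i₀}` and
`(n-1)·Σ_v Σ_{q ≠ j₀} (c_U(v,q)/|U| - [v ≠ i₀]/(n-1))² ≤ n^{C-1}`, one has `|S||T||U|·n^C ≤ (n!)^{3/2}`.
(Pinning + cylinder formula give `nP ≤ 4n^{C-1}(|S||T|)²`, the cost lemma gives
`|S||T| ≤ 4n!·exp(-n^{1-C}/(5000(1+log n)))`, packing gives `|S||T| ≥ N²/n!² > n!/n^{2C}`.) [folklore] -/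
theorem cylinderMember_slack (C : ℝ) (hC0 : 0 ≤ C) (hC : C < 1) :
    ∃ n₀ : ℕ, ∀ n ≥ n₀, ∀ (i₀ j₀ : Fin n) (S T U : Finset (Equiv.Perm (Fin n))),
      TripleProductProperty S T U →
      (∀ s ∈ S, ∀ s' ∈ S, Equiv.Perm.sign s = Equiv.Perm.sign s') →
      (∀ t ∈ T, ∀ t' ∈ T, Equiv.Perm.sign t = Equiv.Perm.sign t') →
      (∀ u ∈ U, ∀ u' ∈ U, Equiv.Perm.sign u = Equiv.Perm.sign u') →
      (∀ u ∈ U, u j₀ = i₀) →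
      ((n : ℝ) - 1) * (∑ v : Fin n, ∑ q ∈ Finset.univ.erase j₀,
          (((U.filter fun u => u q = v).card : ℝ) / U.card -
            (if v = i₀ then (0 : ℝ) else 1 / ((n : ℝ) - 1))) ^ 2) ≤ (n : ℝ) ^ (C - 1) →
      ((S.card * T.card * U.card : ℕ) : ℝ) * (n : ℝ) ^ C ≤ (n.factorial : ℝ) ^ ((3 : ℝ) / 2) := by
  set δ : ℝ := 1 - C with hδ
  have hδ0 : 0 < δ := by rw [hδ]; linarith
  -- thresholds: (a) the polylog bound, (b) `4·n^{C-1} ≤ 9/64`, (c) `n ≥ 40`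
  obtain ⟨n₁, hn₁⟩ := exists_mul_log_sq_le_rpow (5000 * (2 + 2 * C)) δ hδ0
  obtain ⟨n₂, hn₂⟩ := exists_nat_ge (((256 : ℝ) / 9) ^ (1 / δ))
  refine ⟨max (max n₁ n₂) 40, ?_⟩
  intro n hn i₀ j₀ S T U hTPP hS hT hU hUcyl hη
  have hn₁' : n₁ ≤ n := le_trans (le_trans (le_max_left _ _) (le_max_left _ _)) hn
  have hn₂' : n₂ ≤ n := le_trans (le_trans (le_max_right _ _) (le_max_left _ _)) hn
  have hn40 : 40 ≤ n := le_trans (le_max_right _ _) hn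
  have hnR : (40 : ℝ) ≤ n := by exact_mod_cast hn40
  have hn0 : (0 : ℝ) < n := by linarith
  have hn1 : (1 : ℝ) ≤ n := by linarith
  have hm0 : (0 : ℝ) < (n : ℝ) - 1 := by linarith
  have hF0 : (0 : ℝ) < n.factorial := by exact_mod_cast n.factorial_pos
  -- degenerate case `N = 0`
  set Nn : ℕ := S.card * T.card * U.card with hNn
  by_cases hN0 : Nn = 0
  · rw [hN0]; push_cast; rw [zero_mul]; positivity
  have hSne : S.Nonempty := Finset.card_ne_zero.1 fun h => hN0 (by simp [hNn, h])
  have hTne : T.Nonempty := Finset.card_ne_zero.1 fun h => hN0 (by simp [hNn, h])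
  have hUne : U.Nonempty := Finset.card_ne_zero.1 fun h => hN0 (by simp [hNn, h])
  set sR : ℝ := (S.card : ℝ) with hsR
  set tR : ℝ := (T.card : ℝ) with htR
  set uR : ℝ := (U.card : ℝ) with huR
  have hsR0 : 0 < sR := by rw [hsR]; exact_mod_cast hSne.card_pos
  have htR0 : 0 < tR := by rw [htR]; exact_mod_cast hTne.card_pos
  have huR0 : 0 < uR := by rw [huR]; exact_mod_cast hUne.card_pos
  set N : ℝ := sR * tR * uR with hN
  have hN0' : 0 < N := by rw [hN]; positivity
  have eNn : ((Nn : ℕ) : ℝ) = N := by rw [hNn, hN, hsR, htR, huR]; push_cast; ring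
  rw [eNn]
  -- `n!^{3/2} = n!·√(n!)`
  have hrpow : (n.factorial : ℝ) ^ ((3 : ℝ) / 2) = (n.factorial : ℝ) * Real.sqrt (n.factorial : ℝ) := by
    rw [show (3 : ℝ) / 2 = 1 + 1 / 2 by norm_num, Real.rpow_add hF0, Real.rpow_one, Real.sqrt_eq_rpow]
  rw [hrpow]
  by_contra hlt
  have hlt := not_le.1 hlt
  -- abbreviations
  set nC : ℝ := (n : ℝ) ^ C with hnC
  have hnC1 : 1 ≤ nC := Real.one_le_rpow hn1 hC0
  have hnC0 : 0 < nC := by linarith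
  set rt : ℝ := Real.sqrt (n.factorial : ℝ) with hrt
  have hrt0 : 0 < rt := Real.sqrt_pos.2 hF0
  have hrtrt : rt * rt = n.factorial := Real.mul_self_sqrt hF0.le
  -- packing: `|T||U| ≤ n!`, `|U||S| ≤ n!`
  have hTU : tR * uR ≤ n.factorial := by
    have := card_mul_card_le_factorial_of_injOn (injOn_quot_second hTPP hSne)
    rw [htR, huR]; exact_mod_cast this
  have hSU : sR * uR ≤ n.factorial := by
    have := card_mul_card_le_factorial_of_injOn (injOn_quot_outer hTPP hTne)
    rw [hsR, huR]; exact_mod_cast this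
  -- hence `|S||T| ≥ N²/n!²` and, with `N·n^C > n!^{3/2}`, `|S||T|·n^{2C} > n!`
  have hST_lower : (n.factorial : ℝ) < sR * tR * nC ^ 2 := by
    -- N² = (sR tR)(tR uR)(uR sR) ≤ (sR tR) n!², and N nC > n! rt
    have h1 : N ^ 2 ≤ sR * tR * (n.factorial : ℝ) ^ 2 := by
      have e : N ^ 2 = sR * tR * ((tR * uR) * (sR * uR)) := by rw [hN]; ring
      rw [e]
      have h2 : (tR * uR) * (sR * uR) ≤ (n.factorial : ℝ) * n.factorial :=
        mul_le_mul hTU hSU (by positivity) hF0.le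
      have h3 : 0 ≤ sR * tR := by positivity
      nlinarith
    have h2 : (n.factorial : ℝ) * rt < N * nC := hlt
    have h3 : ((n.factorial : ℝ) * rt) ^ 2 < (N * nC) ^ 2 := by
      exact pow_lt_pow_left₀ h2 (by positivity) two_ne_zero
    have h4 : ((n.factorial : ℝ) * rt) ^ 2 = (n.factorial : ℝ) ^ 3 := by
      calc ((n.factorial : ℝ) * rt) ^ 2 = (n.factorial : ℝ) ^ 2 * (rt * rt) := by ring
        _ = (n.factorial : ℝ) ^ 3 := by rw [hrtrt]; ring
    rw [h4, mul_pow] at h3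
    have h5 : (n.factorial : ℝ) ^ 3 < sR * tR * (n.factorial : ℝ) ^ 2 * nC ^ 2 := by
      calc (n.factorial : ℝ) ^ 3 < N ^ 2 * nC ^ 2 := h3
        _ ≤ sR * tR * (n.factorial : ℝ) ^ 2 * nC ^ 2 := by
            exact mul_le_mul_of_nonneg_right h1 (sq_nonneg _)
    have h6 : 0 < (n.factorial : ℝ) ^ 2 := by positivity
    nlinarith
  -- the pinned cylinder formula: `n uR² P ≤ (n-1) N² η' + n! N/2 + N n! rt/(2√D)`
  have hpin := cylinder_pullback_pinned n hn40 S T U hTPP hS hT hU hSne hTne hUne i₀ j₀ hUcyl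
  set P : ℝ := ∑ p : Fin n, ∑ w : Fin n, (((S ×ˢ T).filter fun st => st.2 w = st.1 p).card : ℝ) *
      ((S.filter fun s => s p = i₀).card : ℝ) * ((T.filter fun t => t w = i₀).card : ℝ) with hP
  set η : ℝ := ∑ v : Fin n, ∑ q ∈ Finset.univ.erase j₀,
      (((U.filter fun u => u q = v).card : ℝ) / U.card -
        (if v = i₀ then (0 : ℝ) else 1 / ((n : ℝ) - 1))) ^ 2 with hηdef
  have hη0 : 0 ≤ η := Finset.sum_nonneg fun _ _ => Finset.sum_nonneg fun _ _ => sq_nonneg _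
  set Dr : ℝ := Real.sqrt (((n * (n - 1) : ℕ) : ℝ) / 6) with hDr
  -- `2√D ≥ n/1.3` for `n ≥ 9`: `5n ≤ 13·√D`
  have hD_lower : (5 : ℝ) * n / 13 ≤ Dr := by
    rw [hDr]
    apply Real.le_sqrt_of_sq_le
    have hcast : (((n * (n - 1) : ℕ)) : ℝ) = (n : ℝ) * ((n : ℝ) - 1) := by
      rw [Nat.cast_mul, Nat.cast_sub (by omega : 1 ≤ n), Nat.cast_one]
    rw [hcast, le_div_iff₀ (by norm_num : (0 : ℝ) < 6)]
    have h40 : (n : ℝ) * 40 ≤ n * n := mul_le_mul_of_nonneg_left hnR hn0.le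
    nlinarith [h40]
  have hDr0 : 0 < Dr := lt_of_lt_of_le (by positivity) hD_lower
  -- the three error terms are each `≤ n^{C-1}·(…)` times `(sR tR)² uR²`; we bound `β`
  -- β := ((n-1)η N² ... )/(uR² (sR tR)²) ≤ 4 n^{C-1}; we verify `n P ≤ 4 n^{C-1} (sR tR)²` directly
  have hnCm : (n : ℝ) ^ (C - 1) = nC / n := by
    rw [hnC, Real.rpow_sub hn0, Real.rpow_one]
  have hP4 : (n : ℝ) * P ≤ 4 * (n : ℝ) ^ (C - 1) * (sR * tR) ^ 2 := by
    -- from hpin, dividing by uR² > 0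
    have hN2 : N ^ 2 = (sR * tR) ^ 2 * uR ^ 2 := by rw [hN]; ring
    -- (i) (n-1) N² η ≤ n^{C-1} N²
    have h1 : ((n : ℝ) - 1) * N ^ 2 * η ≤ (n : ℝ) ^ (C - 1) * N ^ 2 := by
      have := mul_le_mul_of_nonneg_left hη (sq_nonneg N)
      linarith [this]
    -- (ii) n! N / 2 ≤ n^{C-1} N²  (since N nC > n! rt ≥ n! · n/2, using rt ≥ n/2)
    have hsq_lower : (n : ℝ) / 2 ≤ rt := by
      apply Real.le_sqrt_of_sq_le
      have : ((n * n : ℕ) : ℝ) ≤ ((4 * n.factorial : ℕ) : ℝ) := by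
        exact_mod_cast sq_le_four_mul_factorial (by omega : 2 ≤ n)
      push_cast at this
      nlinarith
    have h2 : (n.factorial : ℝ) * N / 2 ≤ (n : ℝ) ^ (C - 1) * N ^ 2 := by
      rw [hnCm]
      -- n! ≤ N nC / rt ≤ N nC · 2/n
      have ha : (n.factorial : ℝ) * (n / 2) ≤ N * nC := by
        calc (n.factorial : ℝ) * (n / 2) ≤ (n.factorial : ℝ) * rt :=
              mul_le_mul_of_nonneg_left hsq_lower hF0.le
          _ ≤ N * nC := hlt.le
      have hb := mul_le_mul_of_nonneg_left ha hN0'.le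
      rw [div_mul_eq_mul_div, le_div_iff₀ hn0]
      have e1 : (n.factorial : ℝ) * N / 2 * n = N * ((n.factorial : ℝ) * (n / 2)) := by ring
      have e2 : nC * N ^ 2 = N * (N * nC) := by ring
      rw [e1, e2]; exact hb
    -- (iii) N n! rt/(2 Dr) ≤ 1.3 n^{C-1} N²   (n! rt < N nC and 2 Dr ≥ n/1.3)
    have h3 : N * ((n.factorial : ℝ) * rt) / (2 * Dr) ≤ 13 / 10 * (n : ℝ) ^ (C - 1) * N ^ 2 := by
      rw [hnCm, div_le_iff₀ (by positivity)]
      have ha : N * ((n.factorial : ℝ) * rt) ≤ N * (N * nC) := mul_le_mul_of_nonneg_left hlt.le hN0'.le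
      have hcoef : (1 : ℝ) ≤ 13 / 10 * 2 * Dr / n := by
        rw [le_div_iff₀ hn0]; linarith [hD_lower]
      have hb : N * (N * nC) ≤ 13 / 10 * (nC / n) * N ^ 2 * (2 * Dr) := by
        have hpos : 0 ≤ N ^ 2 * nC := by positivity
        calc N * (N * nC) = N ^ 2 * nC * 1 := by ring
          _ ≤ N ^ 2 * nC * (13 / 10 * 2 * Dr / n) := mul_le_mul_of_nonneg_left hcoef hpos
          _ = 13 / 10 * (nC / n) * N ^ 2 * (2 * Dr) := by rw [div_eq_mul_inv, div_eq_mul_inv]; ring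
      exact ha.trans hb
    -- assemble with hpin
    have hsum : (n : ℝ) * uR ^ 2 * P ≤ 4 * (n : ℝ) ^ (C - 1) * N ^ 2 := by
      have h13 : (0 : ℝ) ≤ 7 / 10 * (n : ℝ) ^ (C - 1) * N ^ 2 := by
        rw [hnCm]; positivity
      linarith [hpin, h1, h2, h3, h13]
    rw [hN2] at hsum
    have hu2 : 0 < uR ^ 2 := by positivity
    have e : (n : ℝ) * uR ^ 2 * P = uR ^ 2 * ((n : ℝ) * P) := by ring
    have e2 : 4 * (n : ℝ) ^ (C - 1) * ((sR * tR) ^ 2 * uR ^ 2) =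
        uR ^ 2 * (4 * (n : ℝ) ^ (C - 1) * (sR * tR) ^ 2) := by ring
    rw [e, e2] at hsum
    exact le_of_mul_le_mul_left hsum hu2
  -- the cost lemma with `β = 4 n^{C-1}`
  set β : ℝ := 4 * (n : ℝ) ^ (C - 1) with hβ
  have hβ0 : 0 < β := by rw [hβ, hnCm]; positivity
  have hnδ : ((256 : ℝ) / 9) ≤ (n : ℝ) ^ δ := by
    have h1 : ((256 : ℝ) / 9) ^ (1 / δ) ≤ n := hn₂.trans (by exact_mod_cast hn₂')
    have h2 := Real.rpow_le_rpow (by positivity) h1 hδ0.le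
    rwa [← Real.rpow_mul (by norm_num), show 1 / δ * δ = 1 by field_simp, Real.rpow_one] at h2
  have hnδ' : (n : ℝ) ^ (C - 1) = 1 / (n : ℝ) ^ δ := by
    rw [hδ, show C - 1 = -(1 - C) by ring, Real.rpow_neg hn0.le, one_div]
  have hβle : β ≤ 9 / 64 := by
    rw [hβ, hnδ']
    have hpos : (0 : ℝ) < (n : ℝ) ^ δ := by positivity
    rw [mul_one_div, div_le_iff₀ hpos]
    nlinarith
  have hcost := quotient_cost (n := n) (by omega) S T hSne hTne (injOn_quot_first hTPP hUne) i₀ β hβ0 hβle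
    (by rw [hβ]; exact hP4)
  -- compare: n! < sR tR nC² ≤ 4 n! exp(-1/(1250(1+log n)β)) nC²
  have hexp : Real.exp (-(1 / (1250 * (1 + Real.log n) * β))) * (4 * nC ^ 2) < 1 := by
    -- 1/(1250(1+log n)β) = n^δ/(5000(1+log n)) ≥ log(4 nC²) + 1
    have hlog0 : 0 ≤ Real.log n := Real.log_nonneg hn1
    have hlog1 : 1 ≤ Real.log n := by
      rw [Real.le_log_iff_exp_le hn0]
      exact le_trans Real.exp_one_lt_d9.le (by linarith)
    set Lg : ℝ := 1 + Real.log n with hLg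
    have hL0 : 0 < Lg := by rw [hLg]; linarith
    have hnδ0 : 0 < (n : ℝ) ^ δ := Real.rpow_pos_of_pos hn0 δ
    have hβ' : β = 4 / (n : ℝ) ^ δ := by rw [hβ, hnδ']; ring
    have hX : (n : ℝ) ^ δ / (5000 * Lg) ≤ 1 / (1250 * Lg * β) := by
      rw [hβ', div_le_div_iff₀ (by positivity) (by positivity)]
      have e : (n : ℝ) ^ δ * (1250 * Lg * (4 / (n : ℝ) ^ δ)) =
          5000 * Lg * ((n : ℝ) ^ δ / (n : ℝ) ^ δ) := by ring
      rw [e, div_self hnδ0.ne']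
      linarith
    have hlog4 : Real.log (4 * nC ^ 2) = Real.log 4 + 2 * C * Real.log n := by
      rw [Real.log_mul (by norm_num) (by positivity), Real.log_pow, hnC, Real.log_rpow hn0]; ring
    have hl4 : Real.log 4 ≤ 2 := by
      have e : Real.log 4 = 2 * Real.log 2 := by
        rw [show (4 : ℝ) = 2 ^ 2 by norm_num, Real.log_pow]; norm_num
      rw [e]; linarith [Real.log_two_lt_d9]
    have hkey' : Real.log (4 * nC ^ 2) + 1 ≤ (n : ℝ) ^ δ / (5000 * Lg) := by
      rw [le_div_iff₀ (by positivity), hlog4]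
      have hpoly := hn₁ n hn₁'
      rw [← hLg] at hpoly
      -- (log 4 + 2C log n + 1)·5000 Lg ≤ 5000(2 + 2C) Lg² ≤ n^δ
      have h2 : Real.log 4 + 2 * C * Real.log n + 1 ≤ (2 + 2 * C) * Lg := by
        rw [hLg]; nlinarith [hl4, hlog1, hC0]
      have h3 : 0 ≤ 5000 * Lg := by positivity
      have h4 : (Real.log 4 + 2 * C * Real.log n + 1) * (5000 * Lg) ≤ (2 + 2 * C) * Lg * (5000 * Lg) :=
        mul_le_mul_of_nonneg_right h2 h3
      have h5 : (2 + 2 * C) * Lg * (5000 * Lg) = 5000 * (2 + 2 * C) * Lg ^ 2 := by ring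
      linarith [h4, h5, hpoly]
    have hkey : Real.log (4 * nC ^ 2) + 1 ≤ 1 / (1250 * Lg * β) := hkey'.trans hX
    have h1 : Real.exp (-(1 / (1250 * Lg * β))) ≤ Real.exp (-(Real.log (4 * nC ^ 2) + 1)) :=
      Real.exp_le_exp.2 (neg_le_neg hkey)
    have h4pos : 0 < 4 * nC ^ 2 := by positivity
    have h2 : Real.exp (-(Real.log (4 * nC ^ 2) + 1)) * (4 * nC ^ 2) = Real.exp (-1) := by
      rw [neg_add, Real.exp_add, Real.exp_neg, Real.exp_log h4pos, mul_comm, ← mul_assoc,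
        mul_inv_cancel₀ h4pos.ne', one_mul]
    have h3 : Real.exp (-1 : ℝ) < 1 := Real.exp_lt_one_iff.2 (by norm_num)
    calc Real.exp (-(1 / (1250 * Lg * β))) * (4 * nC ^ 2)
        ≤ Real.exp (-(Real.log (4 * nC ^ 2) + 1)) * (4 * nC ^ 2) :=
          mul_le_mul_of_nonneg_right h1 h4pos.le
      _ = Real.exp (-1) := h2
      _ < 1 := h3
  have hfinal : sR * tR * nC ^ 2 ≤ (n.factorial : ℝ) *
      (Real.exp (-(1 / (1250 * (1 + Real.log n) * β))) * (4 * nC ^ 2)) := by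
    have := mul_le_mul_of_nonneg_right hcost (sq_nonneg nC)
    linarith [this]
  have : (n.factorial : ℝ) * (Real.exp (-(1 / (1250 * (1 + Real.log n) * β))) * (4 * nC ^ 2)) <
      (n.factorial : ℝ) * 1 := mul_lt_mul_of_pos_left hexp hF0
  linarith

end Summit.MatrixMultiplication.MatrixMultiplication.Theorems.PolynomialSlack
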